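import Literature.NumberTheory.LFunctions.KowalskiMichelHarmonicMoments
import Literature.NumberTheory.LFunctions.KMVMollifiedMomentForms
import Mathlib.NumberTheory.ArithmeticFunction.Moebius
import Mathlib.Analysis.Analytic.Order
import HarnessLib

/-!
# Kowalski–Michel–VanderKam 2000: mollified harmonic moments of `Λ^{(k)}(f, ½)` at prime level
and the non-vanishing proportions `p_k` (result-level statements)

Source: E. Kowalski, P. Michel, J. VanderKam, *Non-vanishing of high derivatives of automorphic
`L`-functions at the center of the critical strip*, J. reine angew. Math. 526 (2000) 1–34 [held:
paper:doi-10-1515-crll-2000-074], §1 (Thms. 1.1, 1.2, Cor. 1.3, (2), (4), Thm. 1.6), §2 ((6), (7),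
(9)), §3 (Lemma 3.2 (12)), §4 Prop. 4.1, §5 Prop. 5.1, §6 ((30), (31), the two displays of p. 19,
Thm. 6.1 (32)), §8 Thm. 8.1. ONE file for the result-level statements of the paper; the main-term
FORMS `(30)–(32)` are the tree's `KMV2000.linForm / offDiagForm / secondMomentForm / ratio /
Admissible` (`KMVMollifiedMomentForms`, the cell's D-fam-1), over which the facts below are stated.

SETTING: `q` prime, weight `2`, `S_2(q)^*` = Hecke-normalised newforms (`newforms0 q 2`),
`L(f, s) = ∑ λ_f(n) n^{−s}` (centre `½`), completed `Λ(f, s) = q̂^s Γ(s + ½) L(f, s)` with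
`q̂ = √q / 2π` (KMV p. 1 — NOT the `q̂ = √q/(2π e^γ)` of Kowalski–Michel 2000 / IK (26.17)),
harmonic weights `ω_f = 1/(4π(f,f))` (`∑ʰ`), mollifier (9)
`M_P(f) = ∑_{m < M} λ_f(m) μ(m) ψ(m)^{−1} m^{−1/2} P(log(M/m)/log M)`, `ψ(m) = ∏_{p ∣ m}(1 + 1/p)`,
`M = q̂^Δ` (`0 < Δ < 1`, `M ∉ ℤ`), `P(0) = P'(0) = 0`; for a polynomial `Q = ∑ a_j Y^j` (even or
odd) the operator `Q̃ = ∑ a_j (log q̂)^{−j} ∂_s^j` and the statistic `Q̃(Λ(f, s))(½)`; generalized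
moments `L^h(P, Q) = ∑ʰ Q̃Λ(f)(½) M_P(f)`, `Q^h(P, Q) = ∑ʰ |Q̃Λ(f)(½) M_P(f)|²` (p. 19).

## What is typed

* Definitions with bodies: `KMV2000.qhat`, `completedL` (`Λ(f,s)` over the continuation of record
  `IwaniecSarnak.entireLSeries`), `derivLambda k` (`Λ^{(k)}(f, ½)`), `psi`, `mollifierP`, `Qtilde`,
  `LhPQ`, `QhPQ`, `IsEvenOrOdd`, `natProportionDeriv`, `pk` (the `liminf` (2) over primes),
  `analyticRank` (order of vanishing of the entire `L`-function at the classical centre `s = 1`).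
* Named facts AS PRINTED: `kmv2000_eq4` (`∑ʰ 1 = 1 + O(q^{−3/2})`), `kmv2000_lemma32` ((12):
  `∑ʰ λ_f(m)λ_f(n) = δ + O((m,n,q)^{1/2}(mn)^{1/2}q^{−3/2})`), `kmv2000_firstMomentPQ` and
  `kmv2000_secondMomentPQ` (the displays of p. 19 = Props. 4.1/5.1 in the form (30)/(31), typed with
  ADDITIVE errors of the printed relative size), `kmv2000_theorem61`, `kmv2000_theorem16_via61`
  (Thm. 1.6 for `Q = Y^k` as the case of Thm. 6.1), `kmv2000_eq2_records` (`p₀ ≥ ¼`, `p₁ ≥ 7/16`,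
  p. 2, attributed there to [I-S, KM2]), `kmv2000_theorem11`, `kmv2000_theorem12_numerical`
  (`p₂ ≥ 0.48254, …, p₅ ≥ 0.49856`), `kmv2000_theorem12_pos`, `kmv2000_corollary13`,
  `kmv2000_theorem81`.

## Faithfulness notes

* Props. 4.1/5.1 and the p. 19 displays print RELATIVE errors `(1 + O((log q)^{−1})) × main`;
  they are typed ADDITIVELY with error `C · q̂^{1/2} (log q̂)^{−2}` resp. `C · q̂ (log q̂)^{−3}` (the
  printed relative error times the printed size of the main term), which is the same statement
  when the main-term bracket is non-zero and avoids the false reading "`L^h = 0` exactly" when it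
  vanishes. Constants depend on `Q, P, Δ` (printed `O_Q`, `O_k`; `P`, `Δ` fixed).
* The second-moment range `0 < Δ < 1` rests on the off-diagonal BOUND Lemma 3.3 (VanderKam /
  Iwaniec–Sarnak), for which the paper refers to [VdK2]/[I-S] "for details" (p. 13); with Weil's
  bound alone the range is `Δ < ½` (p. 8). In Kowalski–Michel's and Iwaniec–Kowalski's units
  (`M = q^Δ`) these are `Δ < ½` resp. `Δ < ¼` (cf. `kowalskiMichel2000_eq50`).
* Lemma 3.2's exact Petersson formula (11) and Lemma 3.3 involve `J₁` and are index-only (no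
  Bessel `J₁` in Mathlib); (12) is typed.
* `p_k` (2) is a `liminf` over primes of a ratio in `[0, 1]`.

## References

* [KowalskiMichelVanderKam2000] as above. [held: paper:doi-10-1515-crll-2000-074 p0001–p0025]
* [IwaniecSarnak2000] (the range `Δ < 1` and `p₀ ≥ ¼`; not held, acq-11417);
  [KowalskiMichel2000] (`p₁ ≥ 7/16`-era companion, `KowalskiMichelHarmonicMoments`).
-/

noncomputable section

open scoped MatrixGroups Real
open CongruenceSubgroup Complex Finset Filter Polynomial
open Literature.NumberTheory.EllipticCurves.ModularForms

namespace Literature.NumberTheory.LFunctions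

namespace KMV2000

variable (q : ℕ) [NeZero q]

/-- KMV's conductor scale `q̂ := √q / (2π)` (p. 1: `Λ(f,s) = q̂^s Γ(s+½) L(f,s)`). Not the
`q̂ = √q/(2π e^γ)` of `KowalskiMichel2000.qhat`. [cite: KowalskiMichelVanderKam2000, §1 p. 1 (definition of q̂)] -/
def qhat : ℝ := Real.sqrt q / (2 * π)

/-- **The completed `L`-function `Λ(f, s) = q̂^s Γ(s + ½) L(f, s)`** of `f ∈ S_2(q)^*` in the
analytic normalisation (centre `½`), with `L(f, s) = E(s + ½)` for the entire continuation of record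
`E = IwaniecSarnak.entireLSeries (cuspCoeff f) 2` of the classical series `∑ a_n n^{−s}`
(classical centre `1`). [cite: KowalskiMichelVanderKam2000, §1 p. 1] -/
def completedL (f : CuspForm (Gamma0 q) 2) (s : ℂ) : ℂ :=
  ((qhat q : ℝ) : ℂ) ^ s * Complex.Gamma (s + 1 / 2) *
    IwaniecSarnak.entireLSeries (cuspCoeff f) 2 (s + 1 / 2)

/-- `Λ^{(k)}(f, ½)`, the `k`-th derivative of the completed `L`-function at the centre
(KMV (2), (6)–(7)). [cite: KowalskiMichelVanderKam2000, (2)] -/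
def derivLambda (k : ℕ) (f : CuspForm (Gamma0 q) 2) : ℂ :=
  iteratedDeriv k (completedL q f) (1 / 2)

/-- `ψ(m) = ∏_{p ∣ m} (1 + 1/p)` (KMV (8)). [cite: KowalskiMichelVanderKam2000, (8)] -/
def psi (m : ℕ) : ℝ :=
  ∏ p ∈ m.primeFactors, (1 + (p : ℝ)⁻¹)

/-- **The KMV mollifier (9)**: `M_P(f) = ∑_{m < M} λ_f(m) μ(m) ψ(m)^{−1} m^{−1/2} P(log(M/m)/log M)`
for a real polynomial `P` (the paper assumes `M ∉ ℤ`, so `m < M ⇔ m ≤ ⌊M⌋`).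
[cite: KowalskiMichelVanderKam2000, (9)] -/
def mollifierP (P : ℝ[X]) (M : ℝ) (f : CuspForm (Gamma0 q) 2) : ℂ :=
  ∑ m ∈ Icc 1 ⌊M⌋₊, GL2Family.heckeLambda f m * (ArithmeticFunction.moebius m : ℂ) *
    (((psi m)⁻¹ * (m : ℝ) ^ (-(1 / 2 : ℝ)) * P.eval (Real.log (M / m) / Real.log M) : ℝ) : ℂ)

/-- **`Q̃(Λ(f, s))(½) := ∑_j a_j (log q̂)^{−j} Λ^{(j)}(f, ½)`** for `Q = ∑ a_j Y^j` (KMV §6, p. 19: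
`Q̃ = Q((log q̂)^{−1} ∂_s)`); for `Q = Y^k` this is `(log q̂)^{−k} Λ^{(k)}(f, ½)`.
[cite: KowalskiMichelVanderKam2000, §6 p. 19 (definition of Q̃)] -/
def Qtilde (Q : ℝ[X]) (f : CuspForm (Gamma0 q) 2) : ℂ :=
  ∑ j ∈ range (Q.natDegree + 1),
    (Q.coeff j : ℂ) * (((Real.log (qhat q))⁻¹ : ℝ) : ℂ) ^ j * derivLambda q j f

/-- The generalized mollified FIRST moment `L^h(P, Q) := ∑ʰ_{f ∈ S_2(q)^*} Q̃(Λ(f,s))(½) M_P(f)`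
(KMV §6 p. 19; for `Q = Y^k`, `(log q̂)^{−k} L^h(P)` of (6)). [cite: KowalskiMichelVanderKam2000, §6 p. 19 (L^h(P,Q))] -/
def LhPQ (P Q : ℝ[X]) (M : ℝ) : ℂ :=
  GL2Family.harmonicSum q 2 (fun f ↦ Qtilde q Q f * mollifierP q P M f)

/-- The generalized mollified SECOND moment `Q^h(P, Q) := ∑ʰ_{f ∈ S_2(q)^*} |Q̃(Λ(f,s))(½) M_P(f)|²`
(KMV §6 p. 19; for `Q = Y^k`, `(log q̂)^{−2k} Q^h(P)` of (7)). [cite: KowalskiMichelVanderKam2000, §6 p. 19 (Q^h(P,Q))] -/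
def QhPQ (P Q : ℝ[X]) (M : ℝ) : ℂ :=
  GL2Family.harmonicSum q 2 (fun f ↦ ((‖Qtilde q Q f * mollifierP q P M f‖ ^ 2 : ℝ) : ℂ))

/-- "`Q` is either an odd or an even polynomial" (hypothesis of KMV Thm. 6.1).
[cite: KowalskiMichelVanderKam2000, Thm. 6.1] -/
def IsEvenOrOdd (Q : ℝ[X]) : Prop :=
  (∀ x : ℝ, Q.eval (-x) = Q.eval x) ∨ (∀ x : ℝ, Q.eval (-x) = -Q.eval x)

/-- The natural proportion `|{f ∈ S_2(q)^* : Λ^{(k)}(f, ½) ≠ 0}| / |S_2(q)^*|` whose `liminf` over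
primes is `p_k` (KMV (2)). [cite: KowalskiMichelVanderKam2000, (2)] -/
def natProportionDeriv (k : ℕ) : ℝ :=
  ({f ∈ newforms0 q 2 | derivLambda q k f ≠ 0}.ncard : ℝ) / ((newforms0 q 2).ncard : ℝ)

/-- **`p_k := liminf_{q → ∞, q prime} |{f ∈ S_2(q)^* : Λ^{(k)}(f, ½) ≠ 0}| / |S_2(q)^*|`** (KMV (2)),
as a `Filter.liminf` along `atTop` on the subtype of primes. [cite: KowalskiMichelVanderKam2000, (2)] -/
def pk (k : ℕ) : ℝ :=
  Filter.liminf (fun p : {n : ℕ // n.Prime} ↦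
    @natProportionDeriv p.1 ⟨p.2.ne_zero⟩ k) atTop

/-- The **analytic rank** `r_f`: the order of vanishing of `L(f, s)` at the centre (KMV p. 2: "the
order of vanishing of `L(f,s)` at `s = ½`, which is the same as that of `Λ(f,s)`"), as the order at
the classical centre `s = 1` of the entire continuation of record (`ℕ∞`; `⊤` only for the zero
function). [cite: KowalskiMichelVanderKam2000, §1 p. 2 (r_f)] -/
def analyticRank (f : CuspForm (Gamma0 q) 2) : ℕ∞ :=
  analyticOrderAt (IwaniecSarnak.entireLSeries (cuspCoeff f) 2) 1

end KMV2000

/-! ### Named facts (Kowalski–Michel–VanderKam 2000), as printed -/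

section Facts

open KMV2000

/-- **KMV 2000, (4).** Printed: "The weights `ω_f` define (asymptotically) a probability measure on
`S_2(q)^*` since `∑ʰ_f 1 = 1 + O(q^{−3/2})`" (`q` prime, weight `2`, `ω_f = 1/(4π(f,f))`).
[cite: KowalskiMichelVanderKam2000, (4)] -/
def kmv2000_eq4 : Prop :=
  ∃ C : ℝ, ∀ (q : ℕ) [NeZero q], q.Prime →
    |IwaniecSarnak.harmonicSum q 2 (fun _ ↦ (1 : ℝ)) - 1| ≤ C * (q : ℝ) ^ (-(3 / 2 : ℝ))

/-- **KMV 2000, Lemma 3.2, (12).** Printed: "Moreover one has the estimation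
`∑ʰ_{f ∈ S_2(q)^*} λ_f(m)λ_f(n) = δ_{m,n} + O((m, n, q)^{1/2} (mn)^{1/2} q^{−3/2})`" (`q` prime,
weight `2`, `m, n ≥ 1`; "sufficient to allow us to take a mollifier of length `M = q̂^Δ` for any
`Δ < 1/2`"). The exact Petersson formula (11) with `J₁` is index-only. [cite: KowalskiMichelVanderKam2000, Lemma 3.2 (12)] -/
def kmv2000_lemma32 : Prop :=
  ∃ C : ℝ, ∀ (q : ℕ) [NeZero q], q.Prime → ∀ m n : ℕ, 1 ≤ m → 1 ≤ n →
    ‖KowalskiMichel2000.pet q m n - (if m = n then 1 else 0)‖ ≤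
      C * Real.sqrt (Nat.gcd (Nat.gcd m n) q) * Real.sqrt ((m : ℝ) * n) * (q : ℝ) ^ (-(3 / 2 : ℝ))

/-- **KMV 2000, §6, first display of p. 19 (= Prop. 4.1 in the form (30)): the mollified first
moment.** Printed: "`L^h(P, Q) = (1 + O_Q(1/log q)) ζ(2) q̂^{1/2} (Δ log q̂)^{−1} (Q(1)P'(1) +
Δ Q'(1) P(1))`" for `0 < Δ < 1`, `M = q̂^Δ` (`∉ ℤ`), `P(0) = P'(0) = 0`, `Q` even or odd; the bracket
is the tree's `KMV2000.linForm Δ P Q`. Typed with an ADDITIVE error `C q̂^{1/2} (log q̂)^{−2}`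
(`C` depending on `P, Q, Δ`), the printed relative error times the printed main-term size.
[cite: KowalskiMichelVanderKam2000, §6 p. 19 (first display) / Prop. 4.1 (30)] -/
def kmv2000_firstMomentPQ : Prop :=
  ∀ P Q : ℝ[X], KMV2000.Admissible P → IsEvenOrOdd Q → ∀ Δ : ℝ, 0 < Δ → Δ < 1 →
    ∃ C : ℝ, ∃ q₀ : ℕ, ∀ (q : ℕ) [NeZero q], q.Prime → q₀ ≤ q →
      (∀ n : ℕ, (n : ℝ) ≠ qhat q ^ Δ) →
        ‖LhPQ q P Q (qhat q ^ Δ) -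
            ((riemannZeta 2 * ((Real.sqrt (qhat q) / (Δ * Real.log (qhat q)) : ℝ) : ℂ)) *
              (KMV2000.linForm Δ P Q : ℂ))‖ ≤
          C * Real.sqrt (qhat q) * (Real.log (qhat q))⁻¹ ^ 2

/-- **KMV 2000, §6, second display of p. 19 (= Prop. 5.1 in the form (31)): the mollified second
moment.** Printed: "`Q^h(P, Q) = (1 + O_Q(1/log q)) 2 q̂ ζ(2)² (Δ² (log q̂)²)^{−1} ×
[(Q(1)P'(1) + ΔQ'(1)P(1))² + Δ^{−1} ∫∫_{[0,1]²} (P''(x)Q(y) − Δ² P(x)Q''(y))² dx dy]` remains true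
as soon as `Q` is either an odd or an even polynomial" — range `0 < Δ < 1` (Prop. 5.1; the
off-diagonal Kloosterman terms contribute `≪ q̂^{1−γ(Δ)}`, Lemma 3.3, details in [I-S]/[VdK2];
with Weil's bound alone only `Δ < ½`), `M = q̂^Δ ∉ ℤ`, `P(0) = P'(0) = 0`; the bracket is the tree's
`KMV2000.secondMomentForm Δ P Q`. ADDITIVE error `C q̂ (log q̂)^{−3}`. This is the prime-level,
weight-`2` SECOND-MOMENT input of the family route on the whole diagonal range (KMV units
`Δ < 1` = mollifier `< q̂ ≈ √q/2π`). [cite: KowalskiMichelVanderKam2000, §6 p. 19 (second display) / Prop. 5.1 (31)] -/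
def kmv2000_secondMomentPQ : Prop :=
  ∀ P Q : ℝ[X], KMV2000.Admissible P → IsEvenOrOdd Q → ∀ Δ : ℝ, 0 < Δ → Δ < 1 →
    ∃ C : ℝ, ∃ q₀ : ℕ, ∀ (q : ℕ) [NeZero q], q.Prime → q₀ ≤ q →
      (∀ n : ℕ, (n : ℝ) ≠ qhat q ^ Δ) →
        ‖QhPQ q P Q (qhat q ^ Δ) -
            ((2 * riemannZeta 2 ^ 2 * ((qhat q / (Δ ^ 2 * Real.log (qhat q) ^ 2) : ℝ) : ℂ)) *
              (KMV2000.secondMomentForm Δ P Q : ℂ))‖ ≤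
          C * qhat q * (Real.log (qhat q))⁻¹ ^ 3

open scoped Classical in
/-- **KMV 2000, Theorem 6.1.** Printed: "Let `Q` be a fixed polynomial which is either odd or even.
Then as `q → +∞` we have `liminf_{q} ∑ʰ_{f : Q̃(Λ(f,s))(½) ≠ 0} 1 ≥ Max_{P,Δ} R(P, Q) =
Max_{P,Δ} 1/(2(1 + R₂(P,Q)))` … `P` ranges over all polynomials such that `P(0) = P'(0) = 0`, and
`Δ` over all real numbers such that `0 < Δ < 1`" (`q` prime); `R(P,Q)` at length `Δ` is the tree's
`KMV2000.ratio Δ P Q`. Typed as: for each admissible `(P, Δ)` and `ε > 0`, eventually (in prime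
`q`) the harmonic measure is `≥ R − ε`. [cite: KowalskiMichelVanderKam2000, Thm. 6.1 (32)] -/
def kmv2000_theorem61 : Prop :=
  ∀ Q : ℝ[X], IsEvenOrOdd Q → ∀ P : ℝ[X], KMV2000.Admissible P → ∀ Δ : ℝ, 0 < Δ → Δ < 1 →
    ∀ ε : ℝ, 0 < ε → ∃ q₀ : ℕ, ∀ (q : ℕ) [NeZero q], q.Prime → q₀ ≤ q →
      KMV2000.ratio Δ P Q - ε ≤ KowalskiMichel2000.hMeasure q (fun f ↦ Qtilde q Q f ≠ 0)

/-- **KMV 2000, Theorem 1.6 through Theorem 6.1 (`Q = Y^k`).** Printed (Thm. 1.6): "For all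
`k ≥ 0`, `liminf_{q→+∞} ∑ʰ_{f, Λ^{(k)}(f,1/2) ≠ 0} 1 ≥ π_k`" with (§7) "`π_k =
1/(2(1 + R₂(P_k, y^k)))`" for the optimal `P_k`; typed in the form delivered by Theorem 6.1 with
`Q = Y^k` (`Q̃Λ(½) = (log q̂)^{−k} Λ^{(k)}(f,½)`, same zero set): for every admissible `P` and
`0 < Δ < 1` the harmonic measure of `{Λ^{(k)}(f, ½) ≠ 0}` is eventually `≥ R(P, Y^k; Δ) − ε`.
[cite: KowalskiMichelVanderKam2000, Thm. 1.6 with §7 (π_k) and Thm. 6.1] -/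
def kmv2000_theorem16_via61 : Prop :=
  ∀ k : ℕ, ∀ P : ℝ[X], KMV2000.Admissible P → ∀ Δ : ℝ, 0 < Δ → Δ < 1 →
    ∀ ε : ℝ, 0 < ε → ∃ q₀ : ℕ, ∀ (q : ℕ) [NeZero q], q.Prime → q₀ ≤ q →
      KMV2000.ratio Δ P (X ^ k) - ε ≤ KowalskiMichel2000.hMeasure q (fun f ↦ derivLambda q k f ≠ 0)

/-- **KMV 2000, Theorem 1.1.** Printed: "We have `p₀ > 0`, and `p₁ > 0`, in other words, a positive
proportion of even forms `f` are such that `L(f, ½) ≠ 0`, and a positive proportion of odd forms are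
such that `L'(f, ½) ≠ 0`" (results of [KM2, VdK1, I-S] summarised; `p_k` = (2)).
[cite: KowalskiMichelVanderKam2000, Thm. 1.1] -/
def kmv2000_theorem11 : Prop :=
  0 < pk 0 ∧ 0 < pk 1

/-- **KMV 2000, p. 2 (the records, attributed to [I-S, KM2]).** Printed: "The currently best bounds
for these constants are `p₀ ≥ 1/4` and `p₁ ≥ 7/16` (see [I-S, KM2])" — `p₀ ≥ ¼` of ALL primitive
forms of prime level (`½` of the even ones) is the Iwaniec–Sarnak 2000 record at exactly the
half-edge. [cite: KowalskiMichelVanderKam2000, §1 p. 2 (after Thm. 1.1)] -/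
def kmv2000_eq2_records : Prop :=
  (1 / 4 : ℝ) ≤ pk 0 ∧ (7 / 16 : ℝ) ≤ pk 1

/-- **KMV 2000, Theorem 1.2 (numerical part).** Printed: "In particular `p₂ ≥ 0.48254,
p₃ ≥ 0.49478, p₄ ≥ 0.49758, p₅ ≥ 0.49856`." [cite: KowalskiMichelVanderKam2000, Thm. 1.2] -/
def kmv2000_theorem12_numerical : Prop :=
  (0.48254 : ℝ) ≤ pk 2 ∧ (0.49478 : ℝ) ≤ pk 3 ∧ (0.49758 : ℝ) ≤ pk 4 ∧ (0.49856 : ℝ) ≤ pk 5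

/-- **KMV 2000, Theorem 1.2 (qualitative part).** Printed: "For all `k ≥ 0`, we have `p_k > 0`. In
fact, `p_k ≥ π_k` where `π_k` is a function satisfying `π_k = ½ − (1/32) k^{−2} + O(k^{−3})`" — only
`p_k > 0` is typed (`π_k` is defined through the optimisation of §7).
[cite: KowalskiMichelVanderKam2000, Thm. 1.2] -/
def kmv2000_theorem12_pos : Prop :=
  ∀ k : ℕ, 0 < pk k

/-- **KMV 2000, Corollary 1.3.** Printed: "If `q` is prime and large enough, then at least 99% of the
forms `f ∈ S_2(q)^*` have `r_f ≤ 4`" (`r_f` the analytic rank). [cite: KowalskiMichelVanderKam2000, Cor. 1.3] -/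
def kmv2000_corollary13 : Prop :=
  ∃ q₀ : ℕ, ∀ (q : ℕ) [NeZero q], q.Prime → q₀ ≤ q →
    (99 / 100 : ℝ) * ((newforms0 q 2).ncard : ℝ) ≤
      ({f ∈ newforms0 q 2 | analyticRank q f ≤ 4}.ncard : ℝ)

/-- **KMV 2000, Theorem 8.1.** Printed: "There exists an absolute constant `C > 0` such that for all
`q` prime `∑_{f ∈ S_2(q)^*} r_f² ≤ C |S_2(q)^*|` and `∑ʰ_{f ∈ S_2(q)^*} r_f² ≤ C`." (Ranks as natural
numbers via `ENat.toNat`; by the theorem itself every `r_f` is finite.)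
[cite: KowalskiMichelVanderKam2000, Thm. 8.1] -/
def kmv2000_theorem81 : Prop :=
  ∃ C : ℝ, 0 < C ∧ ∀ (q : ℕ) [NeZero q], q.Prime →
    (∑ᶠ f ∈ newforms0 q 2, ((analyticRank q f).toNat : ℝ) ^ 2) ≤ C * ((newforms0 q 2).ncard : ℝ) ∧
      IwaniecSarnak.harmonicSum q 2 (fun f ↦ ((analyticRank q f).toNat : ℝ) ^ 2) ≤ C

end Facts

/-! ### Proved: Theorem 1.6-via-6.1 follows from Theorem 6.1 (appended by ls-Bfam-typer-1) -/

section Theorem16From61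

open KMV2000

/-- `Y^k` is an even or an odd polynomial. [cite: KowalskiMichelVanderKam2000, Thm. 6.1 (hypothesis on Q)] -/
theorem isEvenOrOdd_X_pow (k : ℕ) : IsEvenOrOdd ((X : ℝ[X]) ^ k) := by
  rcases Nat.even_or_odd k with h | h
  · left
    intro x
    simp [h.neg_pow]
  · right
    intro x
    simp [h.neg_pow]

/-- For `Q = Y^k`, `Q̃(Λ(f,s))(½) = (log q̂)^{−k} Λ^{(k)}(f, ½)` (KMV §6 p. 19).
[cite: KowalskiMichelVanderKam2000, §6 p. 19 (definition of Q̃)] -/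
theorem Qtilde_X_pow (q : ℕ) [NeZero q] (k : ℕ) (f : CuspForm (Gamma0 q) 2) :
    Qtilde q ((X : ℝ[X]) ^ k) f =
      (((Real.log (qhat q))⁻¹ : ℝ) : ℂ) ^ k * derivLambda q k f := by
  unfold Qtilde
  rw [Polynomial.natDegree_X_pow]
  have h : ∀ j ∈ range (k + 1),
      ((((X : ℝ[X]) ^ k).coeff j : ℝ) : ℂ) * (((Real.log (qhat q))⁻¹ : ℝ) : ℂ) ^ j *
          derivLambda q j f =
        if j = k then (((Real.log (qhat q))⁻¹ : ℝ) : ℂ) ^ k * derivLambda q k f else 0 := by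
    intro j _
    rw [Polynomial.coeff_X_pow]
    split_ifs with hj
    · subst hj; simp
    · simp
  rw [Finset.sum_congr rfl h, Finset.sum_ite_eq' (range (k + 1)) k]
  simp

/-- For prime (indeed any) `q ≥ 40` one has `q̂ = √q/2π > 1`, so `log q̂ ≠ 0`. [folklore] -/
private theorem log_qhat_ne_zero {q : ℕ} [NeZero q] (hq : 40 ≤ q) : Real.log (qhat q) ≠ 0 := by
  have hπ : Real.pi < 3.15 := Real.pi_lt_d2
  have hq' : (40 : ℝ) ≤ (q : ℝ) := by exact_mod_cast hq
  have h4 : (2 * Real.pi) ^ 2 < 40 := by nlinarith [hπ, Real.pi_pos]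
  have hsq : 2 * Real.pi < Real.sqrt q := by
    rw [show (2 * Real.pi : ℝ) = Real.sqrt ((2 * Real.pi) ^ 2) by
      rw [Real.sqrt_sq (by positivity)]]
    exact Real.sqrt_lt_sqrt (by positivity) (by linarith)
  have h1 : 1 < qhat q := by
    unfold qhat
    rw [lt_div_iff₀ (by positivity)]
    linarith
  exact (Real.log_pos h1).ne'

/-- **Theorem 1.6-via-6.1 is a CASE of Theorem 6.1** (`Q = Y^k` is even or odd, and
`{Q̃Λ(½) ≠ 0} = {Λ^{(k)}(f,½) ≠ 0}` once `q̂ > 1`): the named fact `kmv2000_theorem16_via61` follows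
from `kmv2000_theorem61`. PROVED. [cite: KowalskiMichelVanderKam2000, Thm. 1.6 and Thm. 6.1] -/
theorem kmv2000_theorem16_via61_of_theorem61 (h : kmv2000_theorem61) : kmv2000_theorem16_via61 := by
  intro k P hP Δ hΔ hΔ1 ε hε
  obtain ⟨q₀, hq₀⟩ := h ((X : ℝ[X]) ^ k) (isEvenOrOdd_X_pow k) P hP Δ hΔ hΔ1 ε hε
  refine ⟨max q₀ 40, fun q _ hq hqq => ?_⟩
  have h40 : 40 ≤ q := le_trans (le_max_right _ _) hqq
  have hpred : (fun f : CuspForm (Gamma0 q) 2 ↦ Qtilde q ((X : ℝ[X]) ^ k) f ≠ 0) =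
      (fun f ↦ derivLambda q k f ≠ 0) := by
    funext f
    rw [Qtilde_X_pow]
    have hc : (((Real.log (qhat q))⁻¹ : ℝ) : ℂ) ^ k ≠ 0 :=
      pow_ne_zero _ (by exact_mod_cast inv_ne_zero (log_qhat_ne_zero h40))
    exact propext ⟨fun hne hd => hne (by rw [hd, mul_zero]), fun hne hprod =>
      hne ((mul_eq_zero.mp hprod).resolve_left hc)⟩
  have := hq₀ q hq (le_trans (le_max_left _ _) hqq)
  rw [hpred] at this
  exact this

end Theorem16From61

end Literature.NumberTheory.LFunctions
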